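import Literature.AlgebraicGeometry.Modules.PullbackPushforwardGaloisChart
import Literature.AlgebraicGeometry.Modules.PushforwardUnitLocalizing
import HarnessLib

/-!
# Galois charts are inherited by principal opens: invariants of a localisation by an invariant element

Setting of `Modules/PullbackPushforwardGaloisChart`: a morphism of schemes `f : X → Y`, self-maps `τ : K → (X ⟶ X)` over `Y`
(`τ x ≫ f = f`) acting on the functions of the stable opens `f⁻¹V` by `σ_x = (τ x)♯` (`twistRingHom`), and the Chase–Harrison–Rosenberg
chart hypothesis `ChartInvariants f τ hτ V`: «every `K`-invariant function on `f⁻¹V` is `f♯` of a function on `V`»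
(`Γ(f⁻¹V, 𝒪_X)^K = f♯Γ(V, 𝒪_Y)`; Greither, LNM 1534, Ch. 0 §1). For `f` AFFINE, `V` affine and `K` FINITE this hypothesis passes to the
principal opens `D(r) ⊆ V`, `r ∈ Γ(V, 𝒪_Y)` — because `Γ(f⁻¹D(r), 𝒪_X) = Γ(f⁻¹V, 𝒪_X)[1∕f♯r]` (the qcqs lemma, tree
`Modules/PushforwardUnitLocalizing`: numerators and torsion for `f_*𝒪_X`) and INVARIANTS COMMUTE WITH LOCALISATION AT AN INVARIANT ELEMENT
for a finite group: an invariant `b∕(f♯r)^k` has `(f♯r)^{n_x}(σ_x b − b) = 0`, hence `(f♯r)^N(σ_x b − b) = 0` for a common `N`, so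
`(f♯r)^N b` is invariant, descends to some `a`, and `b∕(f♯r)^k = f♯(a ∕ r^{N+k})`.

* `twistRingHom_app` — `σ_x(f♯ a) = f♯ a`; `twistRingHom_map` — `σ_x` commutes with restriction;
* **`chartInvariants_basicOpen`** — `ChartInvariants f τ hτ V → ChartInvariants f τ hτ (Y.basicOpen r)` (`V` affine, `f` affine, `K` finite).

So the Galois charts of a point form a neighbourhood BASIS (principal opens of an affine chart are a basis of it) — the input for gluing
chart-level descent statements (`Modules/PullbackPushforwardDescentChart`) into sheaf-level ones. Everything is proved; no named facts,
no `sorry`. Written for Hodge road №4 (crux stmt-HodgeConjecture-26512, lens line N′; director-hodge (M5)-lite).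

## References

* C. Greither, *Cyclic Galois extensions of commutative rings*, LNM 1534 (1992), Ch. 0 §1 (Galois extensions of rings, invariants,
  base change ∕ localisation). [Greither1992CyclicGalois]
* D. Mumford, *Abelian Varieties* (1970), §7 Thm. 4 (p. 72), §12 Thm. 1 (p. 111). [MumfordAV1970]
* R. Hartshorne, *Algebraic Geometry*, GTM 52 (1977), II Prop. 5.8 (c), Ex. 2.16 (the qcqs lemma). [Hartshorne1977]
-/

noncomputable section

-- `TopCat.Presheaf`/`Scheme.Modules` are not reducible (as in Mathlib's `AlgebraicGeometry/Modules/Sheaf.lean`).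
set_option backward.isDefEq.respectTransparency false

open CategoryTheory AlgebraicGeometry TopologicalSpace Opposite
open AlgebraicGeometry.Scheme.Modules

universe u

namespace Literature.AlgebraicGeometry.Modules

open Literature.AlgebraicGeometry.Motives

variable {X Y : Scheme.{u}} (f : X ⟶ Y) {K : Type u} (τ : K → (X ⟶ X)) (hτ : ∀ x, τ x ≫ f = f)

/-- `σ_x` fixes the functions pulled back from `Y`: `σ_x(f♯(a)) = f♯(a)` (`τ x ≫ f = f`). [cite: MumfordAV1970, §7 Thm. 4 (p. 72)] -/
theorem twistRingHom_app (U : Y.Opens) (x : K) (a : Γ(Y, U)) :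
    twistRingHom f τ hτ U x (f.app U a) = f.app U a := by
  change (f.app U ≫ (τ x).appLE (f ⁻¹ᵁ U) (f ⁻¹ᵁ U) (preimage_preimage_eq f τ hτ x U).ge) a = _
  rw [← Scheme.Hom.comp_appLE (τ x) f U (f ⁻¹ᵁ U) (preimage_preimage_eq f τ hτ x U).ge]
  have hgen : ∀ {f₁ f₂ : X ⟶ Y} (_ : f₁ = f₂) (e₁ : f ⁻¹ᵁ U ≤ f₁ ⁻¹ᵁ U) (e₂ : f ⁻¹ᵁ U ≤ f₂ ⁻¹ᵁ U),
      f₁.appLE U (f ⁻¹ᵁ U) e₁ = f₂.appLE U (f ⁻¹ᵁ U) e₂ := by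
    intro f₁ f₂ e _ _
    subst e
    rfl
  have h : (τ x ≫ f).appLE U (f ⁻¹ᵁ U) (preimage_preimage_eq f τ hτ x U).ge = f.appLE U (f ⁻¹ᵁ U) le_rfl :=
    hgen (hτ x) _ _
  rw [h, Scheme.Hom.appLE_eq_app]

/-- `σ_x` commutes with restriction. [cite: MumfordAV1970, §7 Thm. 4 (p. 72)] -/
theorem twistRingHom_map {U U' : Y.Opens} (k : U' ⟶ U) (x : K) (b : Γ(X, f ⁻¹ᵁ U)) :
    twistRingHom f τ hτ U' x (X.presheaf.map ((Opens.map f.base).map k).op b) =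
      X.presheaf.map ((Opens.map f.base).map k).op (twistRingHom f τ hτ U x b) := by
  change (X.presheaf.map ((Opens.map f.base).map k).op ≫ (τ x).appLE (f ⁻¹ᵁ U') (f ⁻¹ᵁ U') _) b =
    ((τ x).appLE (f ⁻¹ᵁ U) (f ⁻¹ᵁ U) _ ≫ X.presheaf.map ((Opens.map f.base).map k).op) b
  rw [Scheme.Hom.map_appLE, Scheme.Hom.appLE_map]

/-- **GALOIS CHARTS ARE INHERITED BY PRINCIPAL OPENS**: if the `K`-invariant functions on `f⁻¹V` descend to `V` (`ChartInvariants` at an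
AFFINE `V`) and `K` is finite, then the `K`-invariant functions on `f⁻¹D(r)` descend to `D(r)` for every `r ∈ Γ(V, 𝒪_Y)` (`f` affine,
so `f_*𝒪_X` is quasi-coherent: `Γ(f⁻¹D(r), 𝒪_X) = Γ(f⁻¹V, 𝒪_X)[1∕f♯r]`; an invariant fraction `b ∕ (f♯r)^k` has `(f♯r)^N (σ_x b − b) = 0`
for a common `N`, so `(f♯r)^N b` is invariant, descends, and `b∕(f♯r)^k = f♯(a)∕(f♯r)^{N+k}`). [cite: Greither1992CyclicGalois, Ch. 0 §1]
[cite: MumfordAV1970, §7 Thm. 4 (p. 72)] -/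
theorem chartInvariants_basicOpen [Finite K] [IsAffineHom f] {V : Y.Opens} (hV : IsAffineOpen V)
    (hinv : ChartInvariants f τ hτ V) (r : Γ(Y, V)) : ChartInvariants f τ hτ (Y.basicOpen r) := by
  classical
  haveI : Fintype K := Fintype.ofFinite K
  have hloc := IsAffineLocalizing.pushforward_unit (g := f) (X := Y) (Y := X)
  set W := Y.basicOpen r with hW
  have hWV : W ≤ V := Y.basicOpen_le r
  intro b' hb'
  -- numerators: `b|_W = (f♯ r|)^k · b'` for some `b ∈ Γ(f⁻¹V, 𝒪_X)`
  obtain ⟨k, b₀, hb⟩ := hloc.numerator hV r rfl b'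
  let b : Γ(X, f ⁻¹ᵁ V) := b₀
  have hb0 : X.presheaf.map ((Opens.map f.base).map (homOfLE hWV)).op b =
      f.app W (Y.presheaf.map (homOfLE hWV).op r ^ k) * b' := by
    have := hb
    rw [pushforward_unit_smul] at this
    exact this
  -- each `σ_x b − b` vanishes on `f⁻¹W`, hence is killed by a power of `r`
  have hvan : ∀ x, ∃ n : ℕ, f.app V (r ^ n) * (twistRingHom f τ hτ V x b - b) = 0 := fun x => by
    have hres : X.presheaf.map ((Opens.map f.base).map (homOfLE hWV)).op (twistRingHom f τ hτ V x b - b) = 0 := by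
      rw [map_sub, ← twistRingHom_map, hb0, map_mul, hb' x, sub_eq_zero]
      congr 1
      exact twistRingHom_app f τ hτ W x _
    obtain ⟨n, hn⟩ := hloc.torsion hV r (show Γ((Scheme.Modules.pushforward f).obj (SheafOfModules.unit X.ringCatSheaf), V) from
      twistRingHom f τ hτ V x b - b) hWV le_rfl hres
    refine ⟨n, ?_⟩
    have := hn
    rw [pushforward_unit_smul] at this
    exact this
  choose n hn using hvan
  -- a common exponent
  set N := Finset.univ.sup n with hN
  have hN' : ∀ x, f.app V (r ^ N) * (twistRingHom f τ hτ V x b - b) = 0 := fun x => by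
    have hle : n x ≤ N := Finset.le_sup (Finset.mem_univ x)
    obtain ⟨d, hd⟩ := Nat.exists_eq_add_of_le hle
    rw [hd, pow_add, map_mul, mul_comm (f.app V (r ^ n x)), mul_assoc, hn x, mul_zero]
  -- `(f♯ r)^N · b` is invariant, hence descends
  have hinvb : ∀ x, twistRingHom f τ hτ V x (f.app V (r ^ N) * b) = f.app V (r ^ N) * b := fun x => by
    rw [map_mul, twistRingHom_app]
    have := hN' x
    rw [mul_sub, sub_eq_zero] at this
    exact this
  obtain ⟨a, ha⟩ := hinv _ hinvb
  -- descend: `b' = f♯(a|) · (f♯ r|)^{-(N+k)}` with `r|_W` a unit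
  have hu : IsUnit (Y.presheaf.map (homOfLE hWV).op r) := Y.toRingedSpace.isUnit_res_basicOpen r
  obtain ⟨u, hu'⟩ := hu
  refine ⟨Y.presheaf.map (homOfLE hWV).op a * ↑(u⁻¹ ^ (N + k)), ?_⟩
  -- compare after multiplying by the unit `(f♯ r|)^(N+k)`
  have hfu : IsUnit (f.app W (Y.presheaf.map (homOfLE hWV).op r)) := (hu'.symm ▸ u.isUnit).map _
  have hunit : (↑(u⁻¹ ^ (N + k)) : Γ(Y, W)) * Y.presheaf.map (homOfLE hWV).op r ^ (N + k) = 1 := by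
    rw [← hu', ← Units.val_pow_eq_pow_val, ← Units.val_mul, inv_pow, inv_mul_cancel, Units.val_one]
  have hnatV : ∀ c : Γ(Y, V), f.app W (Y.presheaf.map (homOfLE hWV).op c) =
      X.presheaf.map ((Opens.map f.base).map (homOfLE hWV)).op (f.app V c) := fun c =>
    ConcreteCategory.congr_hom (f.naturality (homOfLE hWV).op) c
  have key : f.app W (Y.presheaf.map (homOfLE hWV).op a * ↑(u⁻¹ ^ (N + k))) * f.app W (Y.presheaf.map (homOfLE hWV).op r) ^ (N + k) =
      b' * f.app W (Y.presheaf.map (homOfLE hWV).op r) ^ (N + k) := by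
    rw [map_mul, mul_assoc, ← map_pow, ← map_mul, hunit, map_one, mul_one, hnatV, ha, map_mul, hb0, ← hnatV, map_pow,
      map_pow, map_pow, pow_add]
    simp only [map_mul, map_pow]
    ring
  exact hfu.pow (N + k) |>.mul_left_injective key

end Literature.AlgebraicGeometry.Modules
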